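import Mathlib
import Summits.Ventures.PercRepro2.SwAllLMarkThm

/-!
# An instance of the L-mark step (blind cell PercRepro2, night-4 g30, 2026-08-28;
proofs/NIGHT4-G30.md §8)

`exL` (`Fin 6`, 8 edges; `l = 3`, `h = 1`, the mark `x = 0`): the mark is joined to `l` and, by the
single edge `0–2`, to `p = 2`; `p` is a JUNCTION (no edge to `l`) whose neighbours are the mark,
`h`, and `5` — `5` is not adjacent to `h` and lies with the `h`-neighbour `4` in one component of
the graph without `h, p`: a MIXED component with the mark at the junction's side, admitted by no
junction theorem of record (the census model with every step of record and the H-mark step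
leaves the pair uncovered).  Every vertex other than `l, h, p, x` is joined to `l`, so
`IsLMarkAt.swAll_lMark_of_outEdges` settles it outright (`swAll_exL`).
-/

namespace Summit.Ventures.PercRepro2

namespace LocRows

open Hull

/-- The instance: `l = 3`, `h = 1`, the mark `0` joined to `l` and to the junction `p = 2`. -/
def exL : Fin 8 → Sym2 (Fin 6)
  | 0 => s(0, 2) | 1 => s(0, 3) | 2 => s(1, 2) | 3 => s(1, 4) | 4 => s(2, 5) | 5 => s(3, 4)
  | 6 => s(3, 5) | 7 => s(4, 5)

/-- The mark `0` of `exL` is an L-mark vertex relative to `p = 2` with `e₀ = 0`. -/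
theorem exL_lMark : IsLMarkAt exL 0 2 3 0 where
  xp := by decide
  xl := by decide
  pl := by decide
  ends₀ := rfl
  some_l := ⟨1, rfl⟩
  edges := by decide

/-- **Row 2′SW-ALL on `exL` with the mark at `0`**, by the L-mark step on g10's class. -/
theorem swAll_exL : SwAll exL 3 1 0 :=
  exL_lMark.swAll_lMark_of_outEdges (by decide) (by decide) (by decide) (by decide)

/-- Row (SW) on `exL` with the mark at `0`. -/
theorem sw_exL : Sw exL 3 1 0 := sw_of_swAll exL swAll_exL

end LocRows

end Summit.Ventures.PercRepro2
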